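import Summits.ABC.IUTFork.Repair.RHSharpUpperEdge
import Summits.ABC.IUTFork.Repair.CandInternal2RealHex
import HarnessLib

/-!
# R-H ROUND 1 (D-0107), pair n = 10 — `RHSharpUpperEdgeKill`: the THEOREM-GRADE KILL of H⋆₁₀ «sharp-upper-edge» — at the genuine
# `λ_k = 1/2 + 2/7^k` datum of record, `¬ HStarSharpUpperEdge T.D` past an explicit integer threshold in `(k, l)`

PROOF-ONLY file (0 definitions, 0 `Prop` facts) of the abc-iut cell, D-0079 RESCUE sub-cell R-H («local-height condition I06⋆»), rung
LADDER-ABC:A2.RESCUE.H; seat abc-iut-rh-typ-10 gen 2 (R-H ROUND 1 PAIR n = 10 TYPER; row 10 of `plan/rescue/R-H/RH-CANDIDATES.tsv`, one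
writer abc-iut-rh-lead g0; verdict of record `ROUND1.tsv` row 10 = KILL(k1), FINAL 17:40Z, on abc-iut-rh-typ-10 gen 0's p458024
`RHSharpUpperEdge` + abc-iut-rh-num-1's RH-K1-BATCH-v3). TAKES NO SIDE on [IUTchIII] Cor. 3.12 or on any author. H⋆₁₀ is a CANDIDATE
HYPOTHESIS (claim-tagged `def`, p458024), never a Literature fact; «refuted as typed at OUR genuine datum» ≠ «refuted in print»; typed ≠ proved;
nothing here asserts abc.

WHY. `plan/rescue/R-H/START-HERE.md` §3: «a KILL needs a NAMED row+cell or a NAMED theorem»; §7: «a KILLED H⋆ with a theorem-grade kill is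
knowledge and is listed with its killer». Row 10's k1 = FAIL is of record BY NUMBER (lamSeven 6/256, pooled 107/2570); this file makes the kill
a KERNEL THEOREM on the genuine HEX family of record, with the same binder shape and the same integer trigger as abc-iut-rp-d2's certified NEG of
I06⋆ (`CandInternal2RealHex.i06star_topLabel_false_lamSeven`, p456127, START-HERE §8 A4).

HOW (composition of landed bricks, no new number theory). H⋆₁₀'s cell `SharpCell p e P n` (`∃ a, (n−1)·P + pᵃ ≤ (c + a)·e`) implies print's
cell `(n−1)·P ≤ e·(b_e + c)` (`RHSharpUpperEdge.printCell_of_sharpCell`, from abc-iut-rp-x2's `CandInternal2RealSharp.sharp_le_print`, p454995).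
Over `ℚ_7` with `e ≤ E`, `7·E < 6·7^M` one has `b_e + 1 < M` (`CandInternal2RealHex.logRadiusB_seven_add_one_lt`), and at the TOP label
`n = l⋆²`, `l = 2l⋆ + 1`, with `P·l = k·e` the integer trigger `4·l·M ≤ k·(l−3)(l+1)` says `e·M ≤ (l⋆² − 1)·P`; together
`(l⋆²−1)·P ≤ e·(b_e + 1) < e·M ≤ (l⋆²−1)·P` — absurd (§1 `not_sharpCell_topLabel_seven`). At the genuine datum `T : ThetaVolumeDatumAt
(ratPoint λ_k) l` (§2): abc-iut-c312-7's `Conditional.GenuineK.exists_place_lamSeven` supplies a bad place `x₀ | 7` of `T.K` with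
`e(K_{x₀}/ℚ_7) ≤ 46080·l(l−1)²(l+1)` and `‖t_q(x₀)‖ = 7^{−k/l}` for the CHOSEN realising q-idele (`Cor312Prov.exists_realising_qIdeles_pilotDataOfK`);
abc-iut-C-cert's `Cor312Prov.exists_nat_qPilot_pilotDataOfK` gives `P_{x₀} = P ∈ ℕ`, and abc-iut-w5-d236's `norm_qIdele_eq_rpow_of_realises`
(`‖t_q(x₀)‖ = 7^{−P/e}`) gives `P·l = k·e`; instantiating H⋆₁₀ at `(7, top label, x₀, P)` yields the forbidden cell.

RESULTS (namespace `Summit.ABC.IUTFork.Repair.RHSharpUpperEdge`, continued):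
* §1 `not_sharpCell_topLabel_seven` — the integer trigger kills the H⋆₁₀ top-label cell over `ℚ_7`.
* §2 **`not_hStar_lamSeven`** (MODEL-FREE): `k ≥ 1`, `l` prime `≥ 11`, `7·46080·l(l−1)²(l+1) < 6·7^M`, `4·l·M ≤ k·(l−3)(l+1)` ⟹
  `¬ HStarSharpUpperEdge T.D` for EVERY genuine Θ-volume datum `T` at `(ratPoint λ_k, l)`; numeric rows **`not_hStar_lamSeven_l11`** (`k ≥ 6`)
  and **`not_hStar_lamSeven_l13`** (`k ≥ 5`) — the thresholds of p456127, now for the candidate H⋆₁₀ itself.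
* §4 `not_hStar_of_ramification_le` / `not_hStar_A1` — per fibre point with a SUPPLIED ramification bound `e ≤ E` (R-W's flagged
  local-model input A1 `e ≤ 30·l` as a HYPOTHESIS on the place, never asserted): `¬ H⋆₁₀` from `16·l ≤ k·(l−3)(l+1)` (`k ≥ 2` at `l ∈ {11, 13}`).
READING (neutral, for `ROUND1.tsv` row 10): the KILL(k1) of record is THEOREM-GRADE on the lamSeven family at `l = 11, k ≥ 6` and `l = 13, k ≥ 5`
(model-free; under R-W's flagged local-model input A1 the threshold would drop as in p456127 `…_A1`, not restated here). Since every member of the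
«re-price the one shell» family (rows 7, 10; START-HERE §4 C3) is implied by the real I06⋆ cells and contains H⋆₁₀'s NEG cells only through print's
edge, the same trigger is what kills row 7 (abc-iut-rh-typ-7's `RH.ShellCapacityPlus`, p458688) — not restated here (pair 7's lane).
[cite: Mochizuki2012, IUTchI Def. 3.1 (b),(c) pp. 61–62, Ex. 3.2 (iv) p. 71; IUTchIV Prop. 1.2 (i) p. 10, Cor. 2.2 (ii) proof (P5) p. 46]
[cite: MochizukiAbsTopIII2015, Def 5.4 (iii) p. 126] [cite: NeukirchANT1999, Ch. II (5.5)] [cite: DupuyHilado2025, §3.4]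
[claim: Mochizuki2012, status: disputed] for every IUT sentence quoted. Axioms: standard.
-/

noncomputable section

open Set Metric Function NumberField IsDedekindDomain
open scoped Pointwise

namespace Summit.ABC.IUTFork.Repair.RHSharpUpperEdge

open Literature.AnabelianGeometry.AbsoluteAnabelian Literature.IUT.LogThetaLattice Literature.IUT.LogVolume
  Literature.IUT.LogVolume.RamificationCriterion Literature.IUT.HodgeTheaters Literature.NumberTheory.NumberFields
  Literature.NumberTheory.GaloisRepresentations.Ultrametric Literature.NumberTheory.DiophantineGeometry.GenEll
  Literature.NumberTheory.DiophantineGeometry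
open Summit.ABC.IUTFork.Thm311 Summit.ABC.IUTFork.Thm311.Real Summit.ABC.IUTFork.Cor312 Summit.ABC.IUTFork.Cor312Prov
  Summit.ABC.IUTFork.Conditional Summit.ABC.IUTFork.Repair.CandInternal2RealLabels Summit.ABC.IUTFork.Repair.CandInternal2RealSharp
  Summit.ABC.IUTFork.Repair.CandInternal2RealHex

/-! ## §1. Over `ℚ_7`: the integer trigger kills the top-label H⋆₁₀ cell -/

/-- **TOP-LABEL H⋆₁₀ CELL KILLED BY THE INTEGER TRIGGER (over `ℚ_7`).** For `l` odd, `l ≥ 3`, `1 ≤ e ≤ E`, `7·E < 6·7^M`,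
`4·l·M ≤ k·(l−3)(l+1)` and a pilot degree `P` with `P·l = k·e` (i.e. `P/e = k/l`): `¬ SharpCell 7 e P (l⋆²)`, `l⋆ = (l−1)/2`.
(`SharpCell ⟹` print's cell `(l⋆²−1)·P ≤ e·(b_e + 1)` by `printCell_of_sharpCell`; `b_e + 1 < M` by `logRadiusB_seven_add_one_lt`;
the trigger gives `e·M ≤ (l⋆²−1)·P`.) [cite: Mochizuki2012, IUTchIV Prop. 1.2 (i) p. 10] [cite: NeukirchANT1999, Ch. II (5.5)]
[claim: Mochizuki2012, status: disputed] -/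
theorem not_sharpCell_topLabel_seven {e P k l M E : ℕ} (hl3 : 3 ≤ l) (hodd : Odd l) (he1 : 1 ≤ e) (heE : e ≤ E)
    (hM : 7 * E < 6 * 7 ^ M) (hkM : 4 * l * M ≤ k * ((l - 3) * (l + 1))) (hPl : (P : ℝ) * l = k * e) :
    ¬ SharpCell 7 e P (((l - 1) / 2) ^ 2) := by
  intro h
  have hprint := printCell_of_sharpCell (p := 7) (by norm_num) he1 h
  have hc : ((if (7 : ℕ) = 2 then 2 else 1 : ℕ) : ℝ) = 1 := by norm_num
  rw [hc] at hprint
  have hb : logRadiusB 7 e + 1 < M := logRadiusB_seven_add_one_lt he1 heE hM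
  obtain ⟨l', rfl⟩ := hodd
  have hk' : (2 * l' + 1 - 1) / 2 = l' := by omega
  rw [hk'] at hprint
  have h1l' : 1 ≤ l' := by omega
  have he0 : (0 : ℝ) < e := by exact_mod_cast he1
  have hl0 : (0 : ℝ) < 2 * (l' : ℝ) + 1 := by positivity
  -- the trigger, cast to `ℝ`
  have hkM' : (4 : ℝ) * (2 * l' + 1) * M ≤ k * ((2 * (l' : ℝ) + 1 - 3) * (2 * l' + 1 + 1)) := by
    have hh := (Nat.cast_le (α := ℝ)).2 hkM
    rw [Nat.cast_mul, Nat.cast_mul, Nat.cast_mul, Nat.cast_mul, Nat.cast_sub hl3] at hh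
    push_cast at hh
    linarith
  have hPl' : (P : ℝ) * (2 * (l' : ℝ) + 1) = k * e := by exact_mod_cast hPl
  -- `e·M·(2l'+1) ≤ (l'²−1)·P·(2l'+1)`, then cancel `2l'+1 > 0`
  have hstep : ((M : ℝ) * e) * (2 * (l' : ℝ) + 1) ≤ (((l' : ℝ) ^ 2 - 1) * P) * (2 * (l' : ℝ) + 1) := by
    have h4 : (4 : ℝ) * ((M : ℝ) * e * (2 * (l' : ℝ) + 1)) ≤ 4 * ((((l' : ℝ) ^ 2 - 1) * P) * (2 * (l' : ℝ) + 1)) := by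
      have hmul := mul_le_mul_of_nonneg_right hkM' he0.le
      have hid : (k : ℝ) * ((2 * (l' : ℝ) + 1 - 3) * (2 * l' + 1 + 1)) * e = 4 * (((l' : ℝ) ^ 2 - 1) * (k * e)) := by ring
      rw [hid, ← hPl'] at hmul
      nlinarith
    linarith
  have hME : (M : ℝ) * e ≤ ((l' : ℝ) ^ 2 - 1) * P := le_of_mul_le_mul_right hstep hl0
  have hlt : (e : ℝ) * (logRadiusB 7 e + 1) < e * M := mul_lt_mul_of_pos_left hb he0
  have hprint' : ((l' : ℝ) ^ 2 - 1) * P ≤ e * (logRadiusB 7 e + 1) := by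
    have := hprint
    push_cast at this
    linarith
  linarith

/-! ## §2. At the genuine `λ_k` datum of record: `¬ H⋆₁₀` -/

/-- **THEOREM-GRADE KILL OF H⋆₁₀ ON THE HEX FAMILY (MODEL-FREE).** `k ≥ 1`, `l` prime `≥ 11`, integers `M` with
`7·46080·l(l−1)²(l+1) < 6·7^M` and `4·l·M ≤ k·(l−3)(l+1)`. Then for EVERY genuine Θ-volume datum `T` at `(ratPoint λ_k, l)`,
`λ_k = 1/2 + 2/7^k`, the candidate H⋆₁₀ «sharp-upper-edge» FAILS at the `K`-level pilot datum of `T`: `¬ HStarSharpUpperEdge T.D` — witnessed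
at the bad place `x₀ | 7` of abc-iut-c312-7's `GenuineK.exists_place_lamSeven` and the top label `j = l⋆`.
[cite: Mochizuki2012, IUTchI Def. 3.1 (b),(c) pp. 61–62, Ex. 3.2 (iv) p. 71; IUTchIV Cor. 2.2 (ii) proof (P5) p. 46]
[cite: MochizukiAbsTopIII2015, Def 5.4 (iii) p. 126] [cite: DupuyHilado2025, §3.4] [claim: Mochizuki2012, status: disputed] -/
theorem not_hStar_lamSeven {k l M : ℕ} (hk : 1 ≤ k) (hl : l.Prime) (h11 : 11 ≤ l)
    (hM : 7 * (46080 * (l * (l - 1) ^ 2 * (l + 1))) < 6 * 7 ^ M) (hkM : 4 * l * M ≤ k * ((l - 3) * (l + 1)))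
    (T : Cor22.ThetaVolumeDatumAt (ratPoint ((2 : ℚ)⁻¹ + 2 / 7 ^ k)) l) :
    letI := T.instFieldF; letI := T.instNumberFieldF; letI := T.instAlgebraF; letI := T.instFieldK
    letI := T.instNumberFieldK; letI := T.instAlgebraK; letI := T.instFieldFbar; letI := T.instAlgebraFbar
    letI := T.instAlgebraKFbar; letI := T.instIsElliptic
    ¬ HStarSharpUpperEdge T.D := by
  letI := T.instFieldF; letI := T.instNumberFieldF; letI := T.instAlgebraF; letI := T.instFieldK
  letI := T.instNumberFieldK; letI := T.instAlgebraK; letI := T.instFieldFbar; letI := T.instAlgebraFbar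
  letI := T.instAlgebraKFbar; letI := T.instIsElliptic
  haveI h7 : Fact (Nat.Prime 7) := ⟨by norm_num⟩
  obtain ⟨x₀, hS, -, hbound, -, hnorm⟩ := GenuineK.exists_place_lamSeven hk hl h11 T
  have hspec := (exists_realising_qIdeles_pilotDataOfK T.D).choose_spec
  obtain ⟨P, hP, -, -⟩ := exists_nat_qPilot_pilotDataOfK T.D hS
  intro hH
  -- the top label index `i = l⋆ − 1`
  have hls : (pilotDataOfK T.D T.K).lstar = (l - 1) / 2 := by
    unfold PilotData.lstar
    rw [pilotDataOfK_l]
  let i : Fin (pilotDataOfK T.D T.K).lstar := ⟨(l - 1) / 2 - 1, by rw [hls]; omega⟩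
  have hi : (i : ℕ) + 1 = (l - 1) / 2 := by
    show (l - 1) / 2 - 1 + 1 = (l - 1) / 2
    omega
  have hcell := hH ⟨7, by norm_num⟩ i x₀ hS P hP
  rw [hi] at hcell
  -- ramification indices: Mathlib's `e(x₀|ℤ)` = `absRamificationIdx 7 K_{x₀}` = `ramIdx K x₀`
  have heK : absRamificationIdx 7 (kOf (pilotDataOfK T.D T.K) 7 x₀) =
      (placeOf (pilotDataOfK T.D T.K) 7 x₀).asIdeal.ramificationIdx ℤ :=
    absRamificationIdx_rescaledCompletion T.K 7 (placeOf (pilotDataOfK T.D T.K) 7 x₀)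
      (natCast_mem_placeOf (pilotDataOfK T.D T.K) 7 x₀)
  have hramF : (ramIdx T.K (placeOf (pilotDataOfK T.D T.K) 7 x₀) : ℝ) =
      (absRamificationIdx 7 (kOf (pilotDataOfK T.D T.K) 7 x₀) : ℝ) := by
    rw [ramIdx_eq T.K (placeOf (pilotDataOfK T.D T.K) 7 x₀), heK]
  have he1 : 1 ≤ absRamificationIdx 7 (kOf (pilotDataOfK T.D T.K) 7 x₀) := absRamificationIdx_pos _ _
  have he0 : (0 : ℝ) < (absRamificationIdx 7 (kOf (pilotDataOfK T.D T.K) 7 x₀) : ℝ) := by exact_mod_cast he1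
  -- `P·l = k·e` from the two expressions of `‖t_q(x₀)‖`
  have hnq := norm_qIdele_eq_rpow_of_realises (pilotDataOfK T.D T.K) _ hspec.1 hspec.2.2 ⟨7, by norm_num⟩ x₀
  have hexp : -((k : ℝ) / l) =
      -((pilotDataOfK T.D T.K).qPilot (placeOf (pilotDataOfK T.D T.K) 7 x₀)) /
        (ramIdx T.K (placeOf (pilotDataOfK T.D T.K) 7 x₀) : ℝ) := by
    have h70 : (0 : ℝ) < 7 := by norm_num
    have hlog7 : Real.log 7 ≠ 0 := (Real.log_pos (by norm_num : (1 : ℝ) < 7)).ne'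
    have hboth : (7 : ℝ) ^ (-((k : ℝ) / l)) =
        ((7 : ℕ) : ℝ) ^ (-((pilotDataOfK T.D T.K).qPilot (placeOf (pilotDataOfK T.D T.K) 7 x₀)) /
          (ramIdx T.K (placeOf (pilotDataOfK T.D T.K) 7 x₀) : ℝ)) := by
      rw [← hnorm]; exact hnq
    have hlog := congrArg Real.log hboth
    rw [Nat.cast_ofNat, Real.log_rpow h70, Real.log_rpow h70] at hlog
    exact mul_right_cancel₀ hlog7 hlog
  rw [hP, hramF] at hexp
  have hl0 : (l : ℝ) ≠ 0 := by exact_mod_cast hl.ne_zero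
  have hPl : (P : ℝ) * l = k * (absRamificationIdx 7 (kOf (pilotDataOfK T.D T.K) 7 x₀) : ℝ) := by
    field_simp at hexp
    linarith
  rw [← heK] at hcell
  exact not_sharpCell_topLabel_seven (by omega) (hl.odd_of_ne_two (by omega)) he1 hbound hM hkM hPl hcell

/-! ## §3. Numeric rows (the thresholds of p456127, for H⋆₁₀) -/

/-- **`l = 11`, model-free: `¬ H⋆₁₀` at every `λ_k` datum with `k ≥ 6`** (`M = 11`: `7·46080·11·100·12 < 6·7^11`, `4·11·11 = 484 ≤ 96·k`).
[claim: Mochizuki2012, status: disputed] -/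
theorem not_hStar_lamSeven_l11 {k : ℕ} (hk : 6 ≤ k) (T : Cor22.ThetaVolumeDatumAt (ratPoint ((2 : ℚ)⁻¹ + 2 / 7 ^ k)) 11) :
    letI := T.instFieldF; letI := T.instNumberFieldF; letI := T.instAlgebraF; letI := T.instFieldK
    letI := T.instNumberFieldK; letI := T.instAlgebraK; letI := T.instFieldFbar; letI := T.instAlgebraFbar
    letI := T.instAlgebraKFbar; letI := T.instIsElliptic
    ¬ HStarSharpUpperEdge T.D :=
  not_hStar_lamSeven (M := 11) (by omega) (by norm_num) le_rfl (by norm_num) (by omega) T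

/-- **`l = 13`, model-free: `¬ H⋆₁₀` at every `λ_k` datum with `k ≥ 5`** (`M = 11`: `7·46080·13·144·14 < 6·7^11`, `4·13·11 = 572 ≤ 140·k`).
[claim: Mochizuki2012, status: disputed] -/
theorem not_hStar_lamSeven_l13 {k : ℕ} (hk : 5 ≤ k) (T : Cor22.ThetaVolumeDatumAt (ratPoint ((2 : ℚ)⁻¹ + 2 / 7 ^ k)) 13) :
    letI := T.instFieldF; letI := T.instNumberFieldF; letI := T.instAlgebraF; letI := T.instFieldK
    letI := T.instNumberFieldK; letI := T.instAlgebraK; letI := T.instFieldFbar; letI := T.instAlgebraFbar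
    letI := T.instAlgebraKFbar; letI := T.instIsElliptic
    ¬ HStarSharpUpperEdge T.D :=
  not_hStar_lamSeven (M := 11) (by omega) (by norm_num) (by norm_num) (by norm_num) (by omega) T

/-! ## §4. Per fibre point, with a supplied ramification bound (R-W's flagged local-model input A1 as a HYPOTHESIS on the place) -/

/-- **`¬ H⋆₁₀` FROM ONE FIBRE POINT WITH A SUPPLIED RAMIFICATION BOUND** (the twin of p456127 `i06star_topLabel_false_of_ramification_le`):
`k ≥ 1`, `l` prime `≥ 5`, `7·E < 6·7^M`, `4·l·M ≤ k·(l−3)(l+1)`; if at some `x₀ | 7` the chosen realising q-idele has `‖t_q(x₀)‖ = 7^{−k/l}` and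
`e(K_{x₀}/ℚ_7) ≤ E`, then `¬ HStarSharpUpperEdge T.D` (`x₀` is automatically bad: `‖t_q‖ = 1` off the bad set, `7^{−k/l} < 1`). R-W's local
model (kit job N1, assumption A1 `e(x₀) ∣ 30·l`) is taken here ONLY as the hypothesis `e ≤ E` on the place, never asserted.
[cite: Mochizuki2012, IUTchI Def. 3.1 (b),(c) pp. 61–62, Ex. 3.2 (iv) p. 71] [claim: Mochizuki2012, status: disputed] -/
theorem not_hStar_of_ramification_le {k l M E : ℕ} (hk : 1 ≤ k) (hl : l.Prime) (h5 : 5 ≤ l)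
    (hM : 7 * E < 6 * 7 ^ M) (hkM : 4 * l * M ≤ k * ((l - 3) * (l + 1)))
    (T : Cor22.ThetaVolumeDatumAt (ratPoint ((2 : ℚ)⁻¹ + 2 / 7 ^ k)) l) :
    letI := T.instFieldF; letI := T.instNumberFieldF; letI := T.instAlgebraF; letI := T.instFieldK
    letI := T.instNumberFieldK; letI := T.instAlgebraK; letI := T.instFieldFbar; letI := T.instAlgebraFbar
    letI := T.instAlgebraKFbar; letI := T.instIsElliptic
    haveI : Fact (Nat.Prime 7) := ⟨by norm_num⟩
    ∀ x₀ : (thetaIndex (pilotDataOfK T.D T.K)).Fibre (.inr ⟨7, by norm_num⟩),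
      ‖(exists_realising_qIdeles_pilotDataOfK T.D).choose ⟨7, by norm_num⟩ x₀‖ = (7 : ℝ) ^ (-((k : ℝ) / l)) →
      absRamificationIdx 7 (kOf (pilotDataOfK T.D T.K) 7 x₀) ≤ E → ¬ HStarSharpUpperEdge T.D := by
  letI := T.instFieldF; letI := T.instNumberFieldF; letI := T.instAlgebraF; letI := T.instFieldK
  letI := T.instNumberFieldK; letI := T.instAlgebraK; letI := T.instFieldFbar; letI := T.instAlgebraFbar
  letI := T.instAlgebraKFbar; letI := T.instIsElliptic
  haveI h7 : Fact (Nat.Prime 7) := ⟨by norm_num⟩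
  intro x₀ hnorm hbound hH
  have hspec := (exists_realising_qIdeles_pilotDataOfK T.D).choose_spec
  -- `x₀` is bad: off the bad set the realising q-idele is a unit, but `7^{−k/l} < 1`
  have hS : placeOf (pilotDataOfK T.D T.K) 7 x₀ ∈ (pilotDataOfK T.D T.K).S := by
    by_contra hnot
    have h1 := hspec.2.1 ⟨7, by norm_num⟩ x₀ hnot
    have hl0 : (0 : ℝ) < l := by exact_mod_cast hl.pos
    have hk0 : (0 : ℝ) < k := by exact_mod_cast hk
    have hneg : -((k : ℝ) / l) < 0 := by
      have : (0 : ℝ) < (k : ℝ) / l := div_pos hk0 hl0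
      linarith
    have hlt : (7 : ℝ) ^ (-((k : ℝ) / l)) < 1 := Real.rpow_lt_one_of_one_lt_of_neg (by norm_num) hneg
    have h1' : ‖(exists_realising_qIdeles_pilotDataOfK T.D).choose ⟨7, by norm_num⟩ x₀‖ = 1 := h1
    rw [hnorm] at h1'
    linarith
  obtain ⟨P, hP, -, -⟩ := exists_nat_qPilot_pilotDataOfK T.D hS
  -- the top label index `i = l⋆ − 1`
  have hls : (pilotDataOfK T.D T.K).lstar = (l - 1) / 2 := by
    unfold PilotData.lstar
    rw [pilotDataOfK_l]
  let i : Fin (pilotDataOfK T.D T.K).lstar := ⟨(l - 1) / 2 - 1, by rw [hls]; omega⟩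
  have hi : (i : ℕ) + 1 = (l - 1) / 2 := by
    show (l - 1) / 2 - 1 + 1 = (l - 1) / 2
    omega
  have hcell := hH ⟨7, by norm_num⟩ i x₀ hS P hP
  rw [hi] at hcell
  have heK : absRamificationIdx 7 (kOf (pilotDataOfK T.D T.K) 7 x₀) =
      (placeOf (pilotDataOfK T.D T.K) 7 x₀).asIdeal.ramificationIdx ℤ :=
    absRamificationIdx_rescaledCompletion T.K 7 (placeOf (pilotDataOfK T.D T.K) 7 x₀)
      (natCast_mem_placeOf (pilotDataOfK T.D T.K) 7 x₀)
  have hramF : (ramIdx T.K (placeOf (pilotDataOfK T.D T.K) 7 x₀) : ℝ) =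
      (absRamificationIdx 7 (kOf (pilotDataOfK T.D T.K) 7 x₀) : ℝ) := by
    rw [ramIdx_eq T.K (placeOf (pilotDataOfK T.D T.K) 7 x₀), heK]
  have he1 : 1 ≤ absRamificationIdx 7 (kOf (pilotDataOfK T.D T.K) 7 x₀) := absRamificationIdx_pos _ _
  have hnq := norm_qIdele_eq_rpow_of_realises (pilotDataOfK T.D T.K) _ hspec.1 hspec.2.2 ⟨7, by norm_num⟩ x₀
  have hexp : -((k : ℝ) / l) =
      -((pilotDataOfK T.D T.K).qPilot (placeOf (pilotDataOfK T.D T.K) 7 x₀)) /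
        (ramIdx T.K (placeOf (pilotDataOfK T.D T.K) 7 x₀) : ℝ) := by
    have h70 : (0 : ℝ) < 7 := by norm_num
    have hlog7 : Real.log 7 ≠ 0 := (Real.log_pos (by norm_num : (1 : ℝ) < 7)).ne'
    have hboth : (7 : ℝ) ^ (-((k : ℝ) / l)) =
        ((7 : ℕ) : ℝ) ^ (-((pilotDataOfK T.D T.K).qPilot (placeOf (pilotDataOfK T.D T.K) 7 x₀)) /
          (ramIdx T.K (placeOf (pilotDataOfK T.D T.K) 7 x₀) : ℝ)) := by
      rw [← hnorm]; exact hnq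
    have hlog := congrArg Real.log hboth
    rw [Nat.cast_ofNat, Real.log_rpow h70, Real.log_rpow h70] at hlog
    exact mul_right_cancel₀ hlog7 hlog
  rw [hP, hramF] at hexp
  have hl0 : (l : ℝ) ≠ 0 := by exact_mod_cast hl.ne_zero
  have hPl : (P : ℝ) * l = k * (absRamificationIdx 7 (kOf (pilotDataOfK T.D T.K) 7 x₀) : ℝ) := by
    field_simp at hexp
    linarith
  rw [← heK] at hcell
  exact not_sharpCell_topLabel_seven (by omega) (hl.odd_of_ne_two (by omega)) he1 hbound hM hkM hPl hcell

/-- **Under R-W's local-model input A1 (`e(x₀) ≤ 30·l`) and `l ≤ 68`** (`7·30·l < 6·7^4`, `M = 4`): `¬ H⋆₁₀` as soon as one fibre point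
`x₀ | 7` with `‖t_q(x₀)‖ = 7^{−k/l}` has `e(K_{x₀}/ℚ_7) ≤ 30·l` and `16·l ≤ k·(l−3)(l+1)` — i.e. **`k ≥ 2` at `l ∈ {11, 13}`** (the table's
lamSeven rows `k ≥ 2`: 0/240 hold). A1 is a HYPOTHESIS on the place (R-W kit job N1), never asserted. [claim: Mochizuki2012, status: disputed] -/
theorem not_hStar_A1 {k l : ℕ} (hk : 1 ≤ k) (hl : l.Prime) (h5 : 5 ≤ l) (hl68 : l ≤ 68) (hkl : 16 * l ≤ k * ((l - 3) * (l + 1)))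
    (T : Cor22.ThetaVolumeDatumAt (ratPoint ((2 : ℚ)⁻¹ + 2 / 7 ^ k)) l) :
    letI := T.instFieldF; letI := T.instNumberFieldF; letI := T.instAlgebraF; letI := T.instFieldK
    letI := T.instNumberFieldK; letI := T.instAlgebraK; letI := T.instFieldFbar; letI := T.instAlgebraFbar
    letI := T.instAlgebraKFbar; letI := T.instIsElliptic
    haveI : Fact (Nat.Prime 7) := ⟨by norm_num⟩
    ∀ x₀ : (thetaIndex (pilotDataOfK T.D T.K)).Fibre (.inr ⟨7, by norm_num⟩),
      ‖(exists_realising_qIdeles_pilotDataOfK T.D).choose ⟨7, by norm_num⟩ x₀‖ = (7 : ℝ) ^ (-((k : ℝ) / l)) →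
      absRamificationIdx 7 (kOf (pilotDataOfK T.D T.K) 7 x₀) ≤ 30 * l → ¬ HStarSharpUpperEdge T.D :=
  not_hStar_of_ramification_le (M := 4) (E := 30 * l) hk hl h5 (by omega) (by omega) T

/-- The A1 row at `l = 11`: `16·11 = 176 ≤ k·96` iff `k ≥ 2`. -/
example : ¬ (16 * 11 ≤ 1 * ((11 - 3) * (11 + 1))) ∧ (16 * 11 ≤ 2 * ((11 - 3) * (11 + 1))) := by norm_num

/-- The A1 row at `l = 13`: `16·13 = 208 ≤ k·140` iff `k ≥ 2`. -/
example : ¬ (16 * 13 ≤ 1 * ((13 - 3) * (13 + 1))) ∧ (16 * 13 ≤ 2 * ((13 - 3) * (13 + 1))) := by norm_num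

end Summit.ABC.IUTFork.Repair.RHSharpUpperEdge

end
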